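import Literature.NumberTheory.Rogawski1990.AdelicStableOrbitalSupportFiniteH
import HarnessLib

/-!
# The `H`-adelic stable class READS as a restricted product: `𝒞′_𝐀(γ_H) ≅ {(δ_v)_v : δ_v ∈ 𝒞′_v, δ_v = [(γ_H)_v] a.e.} × 𝒞′_∞` for the endoscopic group
# `H = U(Φ₂) × U(Φ₁)` (Rogawski (1990), §3.3 p. 21, §4.3 p. 44 «`Φ^κ(γ, f) = Π_v Φ^{κ_v}(γ, f_v)`», §5.4 pp. 72–73; Kottwitz (1986) Prop. 7.1)

Topic `NumberTheory/Rogawski1990`; namespace `Literature.NumberTheory.Rogawski1990`; THEOREMS ONLY (no definition, no instance, no named fact, no `sorry`).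
Cell `pub/hodgecm-mathlib`, ENGINE T1, ED 1.19c (xiii″) ∕ O11 — the `H`-SIDE TWIN of the `G`-side dictionary `AdelicStableClassesProduct` (F0P3a-p01): it supplies
the hypotheses (img)(ev)(inj)(surj) of ★ (E1) `Literature.Topology.Algebra.RestrictedProduct.finsum_mem_eq_finsum_mul_prod_finsum_of_factor` for the class set
`𝒞 := adelicStableClassesOverH L γH ⊂ ConjClasses (U(Φ₂)(𝔸) × U(Φ₁)(𝔸))` (★ typer brick `AdelicStableOrbitalIntegral` §3.2, carrier ★ `MatchingAdeleH L γH`) over a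
RATIONAL `γ_H = (γ₂, γ₁) ∈ H(L⁺)`, with the class maps `π_v := ConjClasses.map (toLocal v × toLocal v)`, `π_∞ := ConjClasses.map (archPart × archPart)`, the
local ∕ archimedean stable class sets `St_v := {d | (γ_H)_v ∼_st out d}` (★ `IsLocalStablyConjH`), `St_∞ := {b | γ_H ⊗ 1 ∼_st out b}` (★ `IsArchStablyConjH`),
and the base classes `e_v := [(γ_H)_v]` (★ `rationalComponent`) — on the `H`-side the base point is `γ_H` ITSELF (stable conjugacy WITHIN `H`, no transfer):

* (img) `MatchingAdeleH.isLocalStablyConjH_out_map_toLocal`, `MatchingAdeleH.isArchStablyConjH_out_map_arch`;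
* (ev) `MatchingAdeleH.eventually_map_toLocal_eq_mk` — GIVEN the a.e. `K_v`-conjugacy of [Kt₄] Prop. 7.1 for `U(Φ₂)` at the rational `γ₂` as the
  HYPOTHESIS `hP` (VERBATIM the `hP` of ★ `AdelicStableOrbitalSupportFiniteH`; a theorem by ★ `eventually_forall_integralConj_cmDatum` at `N = 2`, wrapper
  filed separately), the local class is the base class a.e. — the `U(Φ₂)`-coordinate is integral a.e. (★ `eventually_toLocal_mem_cmLocalIntegralLevel`) hence
  `K_v`-conjugate to `(γ₂)_v`, and the `U(Φ₁)`-coordinate IS `(γ₁)_v` (★ `MatchingAdeleH.adele_snd_eq`: in `U(1)` stable conjugacy is equality);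
* (inj) `MatchingAdeleH.eq_of_forall_map_toLocal_eq_of_map_arch_eq` — a class of `𝒞′_𝐀(γ_H)` is determined by its local classes and its archimedean class
  (gluing on the `U(Φ₂)` factor by ★ `UnitaryGroup.isConj_of_isConj_archPart_of_forall_exists_conj`, integral conjugators a.e. from `hP`; rigid second factor);
* (surj) `MatchingAdeleH.exists_mem_classes_of_forall` — every family of local classes in the local stable classes, equal to the base class a.e., with every
  archimedean class in the archimedean stable class, is read by a class of `𝒞′_𝐀(γ_H)` (★ `UnitaryGroup.exists_adelic_of_eventually_mem` on the `U(Φ₂)` factor with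
  the representatives `(γ₂)_v` on the base classes; the `U(Φ₁)` factor is `toAdelic γ₁`, ★ `archPart_cmDatum_toAdelic`).

HC_CM is proved only modulo the printed citations until rung 0 closes; this file is unconditional (the [Kt₄] input is the hypothesis `hP`).

## References
* J. D. Rogawski, *Automorphic Representations of Unitary Groups in Three Variables*, Ann. of Math. Stud. 123 (1990), §3.3 p. 21, §4.3 p. 44, §5.4 pp. 72–73
  [Rogawski1990].
* R. E. Kottwitz, *Stable trace formula: elliptic singular terms*, Math. Ann. 275 (1986), Prop. 7.1 [Kottwitz1986].
* A. Borel, H. Jacquet, *Automorphic forms and automorphic representations*, Proc. Sympos. Pure Math. 33.1 (1979), §4.1 [BorelJacquet1979].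
-/

noncomputable section

open NumberField IsDedekindDomain Filter
open scoped MatrixGroups

namespace Literature.NumberTheory.Rogawski1990

open Literature.NumberTheory.Automorphic
open Literature.AlgebraicGeometry.ShimuraVarieties (unitaryGroup)

section DictionaryH

variable {L : Type} [Field L] [NumberField L] [IsCMField L]
variable {γH : (UnitaryGroup.cmDatum L 2 (Matrix.of fun i j : Fin 2 => if i.val + j.val + 1 = 2 then (1 : L) else 0)).Rational ×
  (UnitaryGroup.cmDatum L 1 (Matrix.of fun i j : Fin 1 => if i.val + j.val + 1 = 1 then (1 : L) else 0)).Rational}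

/-- `ConjClasses.map f [x] = [f x]` (definitional; plumbing for the class maps `π_v`, `π_∞`). [cite: BorelJacquet1979, §4.1] -/
private theorem conjClasses_map_mk' {A B : Type*} [Monoid A] [Monoid B] (f : A →* B) (x : A) :
    ConjClasses.map f (ConjClasses.mk x) = ConjClasses.mk (f x) := rfl

/-- `[out c] = c` (plumbing). [cite: BorelJacquet1979, §4.1] -/
private theorem conjClasses_mk_out_eq' {A : Type*} [Monoid A] (c : ConjClasses A) : ConjClasses.mk (Quotient.out c) = c := by
  rw [← ConjClasses.quotient_mk_eq_mk, Quotient.out_eq]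

/-- `x ∼ out [x]` (plumbing). [cite: BorelJacquet1979, §4.1] -/
private theorem isConj_out_conjClasses_mk' {A : Type*} [Monoid A] (x : A) : IsConj x (Quotient.out (ConjClasses.mk x)) :=
  ConjClasses.mk_eq_mk_iff_isConj.1 (conjClasses_mk_out_eq' _).symm

/-- Conjugacy in a product of groups from conjugacy in the first factor and equality in the second (plumbing: the `U(Φ₁)`-coordinate is rigid).
[cite: Rogawski1990, §3.1 p. 19] -/
private theorem isConj_prod_of_isConj_of_eq {M N : Type*} [Group M] [Group N] {a b : M} {x y : N} (h : IsConj a b) (hxy : x = y) :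
    IsConj (a, x) (b, y) := by
  subst hxy
  obtain ⟨c, hc⟩ := isConj_iff.1 h
  refine isConj_iff.2 ⟨(c, 1), ?_⟩
  rw [← hc]
  ext <;> simp

/-- Classes of a product which agree after `ConjClasses.map (f × g)` have first coordinates with conjugate images under `f` (plumbing for the gluing on the
`U(Φ₂)` factor; proved componentwise, without unfolding the homomorphisms). [cite: Rogawski1990, §3.1 p. 19] -/
private theorem isConj_apply_fst_of_map_prodMap_mk_eq {M N M' N' : Type*} [Group M] [Group N] [Group M'] [Group N'] (f : M →* M') (g : N →* N')
    {z z' : M × N} (h : ConjClasses.map (MonoidHom.prodMap f g) (ConjClasses.mk z) = ConjClasses.map (MonoidHom.prodMap f g) (ConjClasses.mk z')) :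
    IsConj (f z.1) (f z'.1) := by
  obtain ⟨c, hc⟩ := isConj_iff.1 (ConjClasses.mk_eq_mk_iff_isConj.1 h)
  refine isConj_iff.2 ⟨c.1, ?_⟩
  have h1 := congrArg Prod.fst hc
  simpa only [Prod.fst_mul, Prod.fst_inv, MonoidHom.coe_prodMap, Prod.map_fst] using h1

/-! ## §1 (img) local and archimedean classes of `𝒞′_𝐀(γ_H)` lie in the stable classes of `(γ_H)_v`, `γ_H ⊗ 1` -/

/-- **(img, finite places)**: for `c ∈ 𝒞′_𝐀(γ_H)` and a finite place `v`, the representative of its local class `π_v c = ConjClasses.map (toLocal v × toLocal v) c`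
is stably conjugate IN `H_v` to `(γ_H)_v` (★ `MatchingAdeleH.isLocalStablyConjH`; stable conjugacy is transitive and contains conjugacy, ★ `isStablyConjH_of_isConj`).
[cite: Rogawski1990, §3.3 p. 21] -/
theorem MatchingAdeleH.isLocalStablyConjH_out_map_toLocal
    {c : ConjClasses ((UnitaryGroup.cmDatum L 2 (Matrix.of fun i j : Fin 2 => if i.val + j.val + 1 = 2 then (1 : L) else 0)).Adelic ×
      (UnitaryGroup.cmDatum L 1 (Matrix.of fun i j : Fin 1 => if i.val + j.val + 1 = 1 then (1 : L) else 0)).Adelic)}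
    (hc : c ∈ adelicStableClassesOverH L γH) (v : HeightOneSpectrum (𝓞 ↥(maximalRealSubfield L))) :
    IsLocalStablyConjH L v (rationalComponent L γH v)
      (Quotient.out (ConjClasses.map (MonoidHom.prodMap
        ((UnitaryGroup.cmDatum L 2 (Matrix.of fun i j : Fin 2 => if i.val + j.val + 1 = 2 then (1 : L) else 0)).toLocal v)
        ((UnitaryGroup.cmDatum L 1 (Matrix.of fun i j : Fin 1 => if i.val + j.val + 1 = 1 then (1 : L) else 0)).toLocal v)) c)) := by
  obtain ⟨p, rfl⟩ := hc
  exact (p.isLocalStablyConjH v).trans (isStablyConjH_of_isConj (isConj_out_conjClasses_mk' _))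

/-- **(img, archimedean)**: the representative of the archimedean class `π_∞ c = ConjClasses.map (archPart × archPart) c` of `c ∈ 𝒞′_𝐀(γ_H)` is stably conjugate
in `H_∞` to `γ_H ⊗ 1` (★ `MatchingAdeleH.isArchStablyConjH`). [cite: Rogawski1990, §5.4 p. 72] -/
theorem MatchingAdeleH.isArchStablyConjH_out_map_arch
    {c : ConjClasses ((UnitaryGroup.cmDatum L 2 (Matrix.of fun i j : Fin 2 => if i.val + j.val + 1 = 2 then (1 : L) else 0)).Adelic ×
      (UnitaryGroup.cmDatum L 1 (Matrix.of fun i j : Fin 1 => if i.val + j.val + 1 = 1 then (1 : L) else 0)).Adelic)}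
    (hc : c ∈ adelicStableClassesOverH L γH) :
    IsArchStablyConjH L (rationalArch L γH)
      (Quotient.out (ConjClasses.map (MonoidHom.prodMap
        (UnitaryGroup.archPart (↥(maximalRealSubfield L)) L (IsCMField.complexConj L) 2
          (Matrix.of fun i j : Fin 2 => if i.val + j.val + 1 = 2 then (1 : L) else 0))
        (UnitaryGroup.archPart (↥(maximalRealSubfield L)) L (IsCMField.complexConj L) 1
          (Matrix.of fun i j : Fin 1 => if i.val + j.val + 1 = 1 then (1 : L) else 0))) c)) := by
  obtain ⟨p, rfl⟩ := hc
  exact p.isArchStablyConjH.trans (isStablyConjH_of_isConj (isConj_out_conjClasses_mk' _))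

/-! ## §2 (ev) the local class is the base class almost everywhere -/

/-- **(ev)**: given the a.e. `K_v`-conjugacy of [Kt₄] Prop. 7.1 for `U(Φ₂)` at the rational `γ₂ = (γ_H)₁` (hypothesis `hP`, the shape of ★
`AdelicStableOrbitalSupportFiniteH`), the local class of any `c ∈ 𝒞′_𝐀(γ_H)` is the base class `[(γ_H)_v]` for all but finitely many `v`: the `U(Φ₂)`-coordinate of a
matching adèle is integral a.e. (★ `eventually_toLocal_mem_cmLocalIntegralLevel`), hence `K_v`-conjugate to `(γ₂)_v`; the `U(Φ₁)`-coordinate IS `(γ₁)_v`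
(★ `MatchingAdeleH.adele_snd_eq`). [cite: Rogawski1990, §3.3 p. 21] [cite: Kottwitz1986, Prop. 7.1] -/
theorem MatchingAdeleH.eventually_map_toLocal_eq_mk
    (hP : ∀ᶠ v in cofinite, ∀ g : (UnitaryGroup.cmDatum L 2 (Matrix.of fun i j : Fin 2 => if i.val + j.val + 1 = 2 then (1 : L) else 0)).Local v,
      g ∈ UnitaryGroup.cmLocalIntegralLevel L 2 (Matrix.of fun i j : Fin 2 => if i.val + j.val + 1 = 2 then (1 : L) else 0) v →
        IsStablyConj (UnitaryGroup.conjLocal L (IsCMField.complexConj L) v) ((UnitaryGroup.adelicForm L 2 (Matrix.of fun i j : Fin 2 => if i.val + j.val + 1 = 2 then (1 : L) else 0)).map (UnitaryGroup.adeleToLocal L v))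
            ((UnitaryGroup.cmDatum L 2 (Matrix.of fun i j : Fin 2 => if i.val + j.val + 1 = 2 then (1 : L) else 0)).toLocal v ((UnitaryGroup.cmDatum L 2 (Matrix.of fun i j : Fin 2 => if i.val + j.val + 1 = 2 then (1 : L) else 0)).toAdelic γH.1)) g →
          ∃ k ∈ UnitaryGroup.cmLocalIntegralLevel L 2 (Matrix.of fun i j : Fin 2 => if i.val + j.val + 1 = 2 then (1 : L) else 0) v,
            k * (UnitaryGroup.cmDatum L 2 (Matrix.of fun i j : Fin 2 => if i.val + j.val + 1 = 2 then (1 : L) else 0)).toLocal v ((UnitaryGroup.cmDatum L 2 (Matrix.of fun i j : Fin 2 => if i.val + j.val + 1 = 2 then (1 : L) else 0)).toAdelic γH.1) * k⁻¹ = g)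
    {c : ConjClasses ((UnitaryGroup.cmDatum L 2 (Matrix.of fun i j : Fin 2 => if i.val + j.val + 1 = 2 then (1 : L) else 0)).Adelic ×
      (UnitaryGroup.cmDatum L 1 (Matrix.of fun i j : Fin 1 => if i.val + j.val + 1 = 1 then (1 : L) else 0)).Adelic)}
    (hc : c ∈ adelicStableClassesOverH L γH) :
    ∀ᶠ v in cofinite, ConjClasses.map (MonoidHom.prodMap
        ((UnitaryGroup.cmDatum L 2 (Matrix.of fun i j : Fin 2 => if i.val + j.val + 1 = 2 then (1 : L) else 0)).toLocal v)
        ((UnitaryGroup.cmDatum L 1 (Matrix.of fun i j : Fin 1 => if i.val + j.val + 1 = 1 then (1 : L) else 0)).toLocal v)) c =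
      ConjClasses.mk (rationalComponent L γH v) := by
  obtain ⟨p, rfl⟩ := hc
  filter_upwards [hP, eventually_toLocal_mem_cmLocalIntegralLevel p.adele.1] with v hv hint
  obtain ⟨k, -, hk⟩ := hv _ hint (p.isLocalStablyConjH v).1
  rw [conjClasses_map_mk', ConjClasses.mk_eq_mk_iff_isConj]
  show IsConj
    ((UnitaryGroup.cmDatum L 2 (Matrix.of fun i j : Fin 2 => if i.val + j.val + 1 = 2 then (1 : L) else 0)).toLocal v p.adele.1,
      (UnitaryGroup.cmDatum L 1 (Matrix.of fun i j : Fin 1 => if i.val + j.val + 1 = 1 then (1 : L) else 0)).toLocal v p.adele.2)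
    ((UnitaryGroup.cmDatum L 2 (Matrix.of fun i j : Fin 2 => if i.val + j.val + 1 = 2 then (1 : L) else 0)).toLocal v
        ((UnitaryGroup.cmDatum L 2 (Matrix.of fun i j : Fin 2 => if i.val + j.val + 1 = 2 then (1 : L) else 0)).toAdelic γH.1),
      (UnitaryGroup.cmDatum L 1 (Matrix.of fun i j : Fin 1 => if i.val + j.val + 1 = 1 then (1 : L) else 0)).toLocal v
        ((UnitaryGroup.cmDatum L 1 (Matrix.of fun i j : Fin 1 => if i.val + j.val + 1 = 1 then (1 : L) else 0)).toAdelic γH.2))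
  refine isConj_prod_of_isConj_of_eq (isConj_iff.2 ⟨k, hk⟩).symm ?_
  rw [p.adele_snd_eq]

/-! ## §3 (inj) a class of `𝒞′_𝐀(γ_H)` is determined by its local classes and its archimedean class -/

/-- **(inj) — the gluing on the `U(Φ₂)` factor**: given `hP`, two classes of `𝒞′_𝐀(γ_H)` with the same local class at every finite place and the same archimedean
class are EQUAL — their `U(Φ₁)`-coordinates both equal `toAdelic γ₁` (★ `MatchingAdeleH.adele_snd_eq`), and their `U(Φ₂)`-coordinates are conjugate at every place
and, at almost every place, conjugate BY AN INTEGRAL ELEMENT (both being `K_v`-conjugate to `(γ₂)_v` there), so they are `U(Φ₂)(𝔸)`-conjugate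
(★ `UnitaryGroup.isConj_of_isConj_archPart_of_forall_exists_conj` at `N = 2`). [cite: Rogawski1990, §3.3 p. 21; §5.4 p. 72] [cite: Kottwitz1986, Prop. 7.1] -/
theorem MatchingAdeleH.eq_of_forall_map_toLocal_eq_of_map_arch_eq
    (hP : ∀ᶠ v in cofinite, ∀ g : (UnitaryGroup.cmDatum L 2 (Matrix.of fun i j : Fin 2 => if i.val + j.val + 1 = 2 then (1 : L) else 0)).Local v,
      g ∈ UnitaryGroup.cmLocalIntegralLevel L 2 (Matrix.of fun i j : Fin 2 => if i.val + j.val + 1 = 2 then (1 : L) else 0) v →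
        IsStablyConj (UnitaryGroup.conjLocal L (IsCMField.complexConj L) v) ((UnitaryGroup.adelicForm L 2 (Matrix.of fun i j : Fin 2 => if i.val + j.val + 1 = 2 then (1 : L) else 0)).map (UnitaryGroup.adeleToLocal L v))
            ((UnitaryGroup.cmDatum L 2 (Matrix.of fun i j : Fin 2 => if i.val + j.val + 1 = 2 then (1 : L) else 0)).toLocal v ((UnitaryGroup.cmDatum L 2 (Matrix.of fun i j : Fin 2 => if i.val + j.val + 1 = 2 then (1 : L) else 0)).toAdelic γH.1)) g →
          ∃ k ∈ UnitaryGroup.cmLocalIntegralLevel L 2 (Matrix.of fun i j : Fin 2 => if i.val + j.val + 1 = 2 then (1 : L) else 0) v,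
            k * (UnitaryGroup.cmDatum L 2 (Matrix.of fun i j : Fin 2 => if i.val + j.val + 1 = 2 then (1 : L) else 0)).toLocal v ((UnitaryGroup.cmDatum L 2 (Matrix.of fun i j : Fin 2 => if i.val + j.val + 1 = 2 then (1 : L) else 0)).toAdelic γH.1) * k⁻¹ = g)
    {c c' : ConjClasses ((UnitaryGroup.cmDatum L 2 (Matrix.of fun i j : Fin 2 => if i.val + j.val + 1 = 2 then (1 : L) else 0)).Adelic ×
      (UnitaryGroup.cmDatum L 1 (Matrix.of fun i j : Fin 1 => if i.val + j.val + 1 = 1 then (1 : L) else 0)).Adelic)}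
    (hc : c ∈ adelicStableClassesOverH L γH) (hc' : c' ∈ adelicStableClassesOverH L γH)
    (hv : ∀ v : HeightOneSpectrum (𝓞 ↥(maximalRealSubfield L)),
      ConjClasses.map (MonoidHom.prodMap
          ((UnitaryGroup.cmDatum L 2 (Matrix.of fun i j : Fin 2 => if i.val + j.val + 1 = 2 then (1 : L) else 0)).toLocal v)
          ((UnitaryGroup.cmDatum L 1 (Matrix.of fun i j : Fin 1 => if i.val + j.val + 1 = 1 then (1 : L) else 0)).toLocal v)) c =
        ConjClasses.map (MonoidHom.prodMap
          ((UnitaryGroup.cmDatum L 2 (Matrix.of fun i j : Fin 2 => if i.val + j.val + 1 = 2 then (1 : L) else 0)).toLocal v)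
          ((UnitaryGroup.cmDatum L 1 (Matrix.of fun i j : Fin 1 => if i.val + j.val + 1 = 1 then (1 : L) else 0)).toLocal v)) c')
    (ha : ConjClasses.map (MonoidHom.prodMap
          (UnitaryGroup.archPart (↥(maximalRealSubfield L)) L (IsCMField.complexConj L) 2
            (Matrix.of fun i j : Fin 2 => if i.val + j.val + 1 = 2 then (1 : L) else 0))
          (UnitaryGroup.archPart (↥(maximalRealSubfield L)) L (IsCMField.complexConj L) 1
            (Matrix.of fun i j : Fin 1 => if i.val + j.val + 1 = 1 then (1 : L) else 0))) c =
        ConjClasses.map (MonoidHom.prodMap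
          (UnitaryGroup.archPart (↥(maximalRealSubfield L)) L (IsCMField.complexConj L) 2
            (Matrix.of fun i j : Fin 2 => if i.val + j.val + 1 = 2 then (1 : L) else 0))
          (UnitaryGroup.archPart (↥(maximalRealSubfield L)) L (IsCMField.complexConj L) 1
            (Matrix.of fun i j : Fin 1 => if i.val + j.val + 1 = 1 then (1 : L) else 0))) c') :
    c = c' := by
  obtain ⟨p, rfl⟩ := hc
  obtain ⟨p', rfl⟩ := hc'
  dsimp only at hv ha ⊢
  rw [ConjClasses.mk_eq_mk_iff_isConj]
  -- second coordinates are rigid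
  have hsnd : p.adele.2 = p'.adele.2 := by rw [p.adele_snd_eq, p'.adele_snd_eq]
  -- first coordinates: conjugate at `∞` and at every finite place …
  have ha1 : IsConj
      (UnitaryGroup.archPart (↥(maximalRealSubfield L)) L (IsCMField.complexConj L) 2
        (Matrix.of fun i j : Fin 2 => if i.val + j.val + 1 = 2 then (1 : L) else 0) p.adele.1)
      (UnitaryGroup.archPart (↥(maximalRealSubfield L)) L (IsCMField.complexConj L) 2
        (Matrix.of fun i j : Fin 2 => if i.val + j.val + 1 = 2 then (1 : L) else 0) p'.adele.1) :=
    isConj_apply_fst_of_map_prodMap_mk_eq _ _ ha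
  have hv1 : ∀ v : HeightOneSpectrum (𝓞 ↥(maximalRealSubfield L)),
      IsConj ((UnitaryGroup.cmDatum L 2 (Matrix.of fun i j : Fin 2 => if i.val + j.val + 1 = 2 then (1 : L) else 0)).toLocal v p.adele.1)
        ((UnitaryGroup.cmDatum L 2 (Matrix.of fun i j : Fin 2 => if i.val + j.val + 1 = 2 then (1 : L) else 0)).toLocal v p'.adele.1) := fun v =>
    isConj_apply_fst_of_map_prodMap_mk_eq _ _ (hv v)
  -- … and by an integral element at almost every place
  have hK : ∀ᶠ v in cofinite, ∃ k : (UnitaryGroup.cmDatum L 2 (Matrix.of fun i j : Fin 2 => if i.val + j.val + 1 = 2 then (1 : L) else 0)).Local v,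
      k ∈ UnitaryGroup.cmLocalIntegralLevel L 2 (Matrix.of fun i j : Fin 2 => if i.val + j.val + 1 = 2 then (1 : L) else 0) v ∧
        k * (UnitaryGroup.cmDatum L 2 (Matrix.of fun i j : Fin 2 => if i.val + j.val + 1 = 2 then (1 : L) else 0)).toLocal v p.adele.1 * k⁻¹ =
          (UnitaryGroup.cmDatum L 2 (Matrix.of fun i j : Fin 2 => if i.val + j.val + 1 = 2 then (1 : L) else 0)).toLocal v p'.adele.1 := by
    filter_upwards [hP, eventually_toLocal_mem_cmLocalIntegralLevel p.adele.1, eventually_toLocal_mem_cmLocalIntegralLevel p'.adele.1]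
      with v hPv hint hint'
    obtain ⟨k, hk, hkp⟩ := hPv _ hint (p.isLocalStablyConjH v).1
    obtain ⟨k', hk', hkp'⟩ := hPv _ hint' (p'.isLocalStablyConjH v).1
    refine ⟨k' * k⁻¹, mul_mem hk' (inv_mem hk), ?_⟩
    rw [← hkp, ← hkp', mul_inv_rev, inv_inv]
    group
  have hconj1 : IsConj p.adele.1 p'.adele.1 :=
    UnitaryGroup.isConj_of_isConj_archPart_of_forall_exists_conj (↥(maximalRealSubfield L)) L (IsCMField.complexConj L) 2
      (Matrix.of fun i j : Fin 2 => if i.val + j.val + 1 = 2 then (1 : L) else 0) ha1 hv1 hK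
  obtain ⟨x, hx⟩ := isConj_iff.1 hconj1
  refine isConj_iff.2 ⟨(x, 1), Prod.ext ?_ ?_⟩
  · simpa only [Prod.fst_mul, Prod.fst_inv] using hx
  · simp only [Prod.snd_mul, Prod.snd_inv, inv_one, mul_one, one_mul, hsnd]

/-! ## §4 (surj) every admissible family of local classes and archimedean class is read by a class of `𝒞′_𝐀(γ_H)` -/

/-- **(surj)**: every family `δ` of local classes of `H_v = U(Φ₂)_v × U(Φ₁)_v` with `(γ_H)_v ∼_st out (δ v)` at every `v` and `δ v = [(γ_H)_v]` for almost all `v`,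
together with every archimedean class `b` with `γ_H ⊗ 1 ∼_st out b`, is the family of local ∕ archimedean classes of some `c ∈ 𝒞′_𝐀(γ_H)`: the `U(Φ₁)`-coordinates
are forced (`(γ₁)_v`, `γ₁ ⊗ 1` — stable conjugacy in `U(1)` is equality, ★ `eq_of_isStablyConj_fin_one`), and the `U(Φ₂)`-coordinates glue (representatives
`(γ₂)_v` on the base classes, integral a.e. ★ `eventually_toLocal_mem_cmLocalIntegralLevel`; ★ `UnitaryGroup.exists_adelic_of_eventually_mem`); the glued
adèle `(x, toAdelic γ₁)` is `H`-matching since `∼_st` is constant on conjugacy classes. [cite: Rogawski1990, §3.3 p. 21; §5.4 p. 72] [cite: BorelJacquet1979, §4.1] -/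
theorem MatchingAdeleH.exists_mem_classes_of_forall
    (δ : ∀ v : HeightOneSpectrum (𝓞 ↥(maximalRealSubfield L)),
      ConjClasses ((UnitaryGroup.cmDatum L 2 (Matrix.of fun i j : Fin 2 => if i.val + j.val + 1 = 2 then (1 : L) else 0)).Local v ×
        (UnitaryGroup.cmDatum L 1 (Matrix.of fun i j : Fin 1 => if i.val + j.val + 1 = 1 then (1 : L) else 0)).Local v))
    (b : ConjClasses (↥(UnitaryGroup.arch (↥(maximalRealSubfield L)) L (IsCMField.complexConj L) 2
        (Matrix.of fun i j : Fin 2 => if i.val + j.val + 1 = 2 then (1 : L) else 0)) ×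
      ↥(UnitaryGroup.arch (↥(maximalRealSubfield L)) L (IsCMField.complexConj L) 1
        (Matrix.of fun i j : Fin 1 => if i.val + j.val + 1 = 1 then (1 : L) else 0))))
    (hδ : ∀ v, IsLocalStablyConjH L v (rationalComponent L γH v) (Quotient.out (δ v)))
    (hev : ∀ᶠ v in cofinite, δ v = ConjClasses.mk (rationalComponent L γH v))
    (hb : IsArchStablyConjH L (rationalArch L γH) (Quotient.out b)) :
    ∃ c ∈ adelicStableClassesOverH L γH,
      (∀ v, ConjClasses.map (MonoidHom.prodMap
          ((UnitaryGroup.cmDatum L 2 (Matrix.of fun i j : Fin 2 => if i.val + j.val + 1 = 2 then (1 : L) else 0)).toLocal v)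
          ((UnitaryGroup.cmDatum L 1 (Matrix.of fun i j : Fin 1 => if i.val + j.val + 1 = 1 then (1 : L) else 0)).toLocal v)) c = δ v) ∧
      ConjClasses.map (MonoidHom.prodMap
          (UnitaryGroup.archPart (↥(maximalRealSubfield L)) L (IsCMField.complexConj L) 2
            (Matrix.of fun i j : Fin 2 => if i.val + j.val + 1 = 2 then (1 : L) else 0))
          (UnitaryGroup.archPart (↥(maximalRealSubfield L)) L (IsCMField.complexConj L) 1
            (Matrix.of fun i j : Fin 1 => if i.val + j.val + 1 = 1 then (1 : L) else 0))) c = b := by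
  classical
  -- the `U(Φ₁)`-coordinates are forced
  have hδ2 : ∀ v, (Quotient.out (δ v)).2 = (rationalComponent L γH v).2 := fun v => (eq_of_isStablyConj_fin_one (hδ v).2).symm
  have hb2 : (Quotient.out b).2 = (rationalArch L γH).2 := (eq_of_isStablyConj_fin_one hb.2).symm
  -- representatives of the `U(Φ₂)`-coordinates: `(γ₂)_v` on the base classes, `(out (δ v)).1` elsewhere
  let γv : ∀ v : HeightOneSpectrum (𝓞 ↥(maximalRealSubfield L)),
      (UnitaryGroup.cmDatum L 2 (Matrix.of fun i j : Fin 2 => if i.val + j.val + 1 = 2 then (1 : L) else 0)).Local v := fun v =>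
    (UnitaryGroup.cmDatum L 2 (Matrix.of fun i j : Fin 2 => if i.val + j.val + 1 = 2 then (1 : L) else 0)).toLocal v
      ((UnitaryGroup.cmDatum L 2 (Matrix.of fun i j : Fin 2 => if i.val + j.val + 1 = 2 then (1 : L) else 0)).toAdelic γH.1)
  let y : ∀ v : HeightOneSpectrum (𝓞 ↥(maximalRealSubfield L)),
      (UnitaryGroup.cmDatum L 2 (Matrix.of fun i j : Fin 2 => if i.val + j.val + 1 = 2 then (1 : L) else 0)).Local v := fun v =>
    if δ v = ConjClasses.mk (rationalComponent L γH v) then γv v else (Quotient.out (δ v)).1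
  have hy_mk : ∀ v, ConjClasses.mk (y v, (rationalComponent L γH v).2) = δ v := by
    intro v
    by_cases h : δ v = ConjClasses.mk (rationalComponent L γH v)
    · rw [show y v = γv v from if_pos h, h]
      rfl
    · rw [show y v = (Quotient.out (δ v)).1 from if_neg h, ← hδ2 v, Prod.mk.eta, conjClasses_mk_out_eq']
  have hy_int : ∀ᶠ v in cofinite, y v ∈ UnitaryGroup.localIntegralLevel (IsCMField.complexConj L) 2
      (Matrix.of fun i j : Fin 2 => if i.val + j.val + 1 = 2 then (1 : L) else 0) v := by
    filter_upwards [hev, eventually_toLocal_mem_cmLocalIntegralLevel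
      ((UnitaryGroup.cmDatum L 2 (Matrix.of fun i j : Fin 2 => if i.val + j.val + 1 = 2 then (1 : L) else 0)).toAdelic γH.1)] with v hv hint
    rw [show y v = γv v from if_pos hv]
    exact hint
  obtain ⟨x, hxa, hxv⟩ := UnitaryGroup.exists_adelic_of_eventually_mem (↥(maximalRealSubfield L)) L (IsCMField.complexConj L) 2
    (Matrix.of fun i j : Fin 2 => if i.val + j.val + 1 = 2 then (1 : L) else 0) (Quotient.out b).1 y hy_int
  -- read `x` and its components on the `cmDatum` carriers (definitionally the same objects)
  have hxv' : ∀ v, (UnitaryGroup.cmDatum L 2 (Matrix.of fun i j : Fin 2 => if i.val + j.val + 1 = 2 then (1 : L) else 0)).toLocal v x = y v :=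
    fun v => hxv v
  have hxa' : UnitaryGroup.archPart (↥(maximalRealSubfield L)) L (IsCMField.complexConj L) 2
      (Matrix.of fun i j : Fin 2 => if i.val + j.val + 1 = 2 then (1 : L) else 0) x = (Quotient.out b).1 := hxa
  -- the glued `U(Φ₂)`-coordinate is stably conjugate to `(γ₂)_v` everywhere
  have hx1 : ∀ v, IsStablyConj (UnitaryGroup.conjLocal L (IsCMField.complexConj L) v)
      ((UnitaryGroup.adelicForm L 2 (Matrix.of fun i j : Fin 2 => if i.val + j.val + 1 = 2 then (1 : L) else 0)).map (UnitaryGroup.adeleToLocal L v))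
      (γv v) ((UnitaryGroup.cmDatum L 2 (Matrix.of fun i j : Fin 2 => if i.val + j.val + 1 = 2 then (1 : L) else 0)).toLocal v x) := by
    intro v
    rw [hxv' v]
    by_cases h : δ v = ConjClasses.mk (rationalComponent L γH v)
    · rw [show y v = γv v from if_pos h]
      exact IsStablyConj.refl _
    · rw [show y v = (Quotient.out (δ v)).1 from if_neg h]
      exact (hδ v).1
  -- the `H`-matching adèle `(x, toAdelic γ₁)`
  let q : MatchingAdeleH L γH :=
    ⟨(x, (UnitaryGroup.cmDatum L 1 (Matrix.of fun i j : Fin 1 => if i.val + j.val + 1 = 1 then (1 : L) else 0)).toAdelic γH.2),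
      fun v => ⟨hx1 v, IsStablyConj.refl _⟩,
      ⟨by
        show IsStablyConj _ _ (rationalArch L γH).1
          (UnitaryGroup.archPart (↥(maximalRealSubfield L)) L (IsCMField.complexConj L) 2
            (Matrix.of fun i j : Fin 2 => if i.val + j.val + 1 = 2 then (1 : L) else 0) x)
        rw [hxa']
        exact hb.1,
       by
        show IsStablyConj _ _ (rationalArch L γH).2
          (UnitaryGroup.archPart (↥(maximalRealSubfield L)) L (IsCMField.complexConj L) 1
            (Matrix.of fun i j : Fin 1 => if i.val + j.val + 1 = 1 then (1 : L) else 0)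
            ((UnitaryGroup.cmDatum L 1 (Matrix.of fun i j : Fin 1 => if i.val + j.val + 1 = 1 then (1 : L) else 0)).toAdelic γH.2))
        rw [archPart_cmDatum_toAdelic]
        exact IsStablyConj.refl _⟩⟩
  have harch2 : UnitaryGroup.archPart (↥(maximalRealSubfield L)) L (IsCMField.complexConj L) 1
      (Matrix.of fun i j : Fin 1 => if i.val + j.val + 1 = 1 then (1 : L) else 0)
      ((UnitaryGroup.cmDatum L 1 (Matrix.of fun i j : Fin 1 => if i.val + j.val + 1 = 1 then (1 : L) else 0)).toAdelic γH.2) = (Quotient.out b).2 := by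
    rw [archPart_cmDatum_toAdelic, hb2]
    rfl
  refine ⟨ConjClasses.mk q.adele, ⟨q, rfl⟩, fun v => ?_, ?_⟩
  · exact (congrArg ConjClasses.mk (Prod.ext (hxv' v) rfl) :
        ConjClasses.mk ((UnitaryGroup.cmDatum L 2 (Matrix.of fun i j : Fin 2 => if i.val + j.val + 1 = 2 then (1 : L) else 0)).toLocal v x,
            (UnitaryGroup.cmDatum L 1 (Matrix.of fun i j : Fin 1 => if i.val + j.val + 1 = 1 then (1 : L) else 0)).toLocal v
              ((UnitaryGroup.cmDatum L 1 (Matrix.of fun i j : Fin 1 => if i.val + j.val + 1 = 1 then (1 : L) else 0)).toAdelic γH.2)) =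
          ConjClasses.mk (y v, (rationalComponent L γH v).2)).trans (hy_mk v)
  · exact (congrArg ConjClasses.mk (Prod.ext hxa' harch2) :
        ConjClasses.mk (UnitaryGroup.archPart (↥(maximalRealSubfield L)) L (IsCMField.complexConj L) 2
              (Matrix.of fun i j : Fin 2 => if i.val + j.val + 1 = 2 then (1 : L) else 0) x,
            UnitaryGroup.archPart (↥(maximalRealSubfield L)) L (IsCMField.complexConj L) 1
              (Matrix.of fun i j : Fin 1 => if i.val + j.val + 1 = 1 then (1 : L) else 0)
              ((UnitaryGroup.cmDatum L 1 (Matrix.of fun i j : Fin 1 => if i.val + j.val + 1 = 1 then (1 : L) else 0)).toAdelic γH.2)) =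
          ConjClasses.mk (Quotient.out b)).trans (conjClasses_mk_out_eq' b)

end DictionaryH

end Literature.NumberTheory.Rogawski1990

end
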